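import Mathlib
import Summits.NavierStokesRegularity.FluidComputer.AbcClassISynthesis
import Summits.NavierStokesRegularity.FluidComputer.AbcInertiaIndexSets

/-!
# INERTIA-3L instantiation — CLASS I twin (instab3 g8; cert-3 g9's `AbcClassI` layer; character-free lemmas
# reused from the class-II files `AbcInertia*`). Part 2: the BALL index sets of a certificate and their structure (R3)/(R4)
# (instab3 g8, cell `ns-blowup`, 2026-08-27)

HONEST FRAMING (human ruling D-0035): nothing here is a claim about Navier–Stokes blow-up.
WHAT THIS IS NOT: not NS evidence. MODEL lane (forced-ABC linearisation, class II, coordinates of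
`AbcClassIIDefs`); no certificate, number or census word moves.

An INERTIA-3L certificate (`HOME/instab3/PREREG-INERTIA-3L.md`, INSTAB3-METHOD §14.2; INERTIA-I4 §3) cuts the
class-II index type `AbcClassI.Idx` by the EUCLIDEAN norm of the orbits: head `L = {|O|² ≤ r_L²}`, junction head
`H = {|O|² ≤ r_H²} ⊇ L`, first tail shell `B = {r_H² < |O|² ≤ (r_H+1)²}`, `r_H ≥ r_L + 1`. This file takes
the three index sets as `Finset`s characterised by membership and proves the structural facts the format
calls (R4) and the per-index form of the tail constant (R3):

* §1 adjacency is Euclidean-local: `j ∈ AbcClassI.nbrIdx i ⇒ |√|O_j|² − √|O_i|²| ≤ 1` (`|k ± e_m| ≤ |k| + 1`);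
* §2 (R4): neighbours of `L` lie in `H`; neighbours of `H` outside `H` lie in `B`; an index outside `H` with
  a neighbour in `H` lies in `B` and that neighbour is not in `L`; `AbcClassI.amat` vanishes across `L × B`;
  `H ∩ B = ∅`, `L ⊆ H`;
* §3 (R3) per index: `|O|²` is a natural number, so `√2 < (⌊r_H²⌋ + 1)/R + a` gives
  `0 < |O_i|²/R + a − √2` for every `i ∉ H`;
* §4 the three index sets EXIST as `Finset`s (`exists_ballIdx`, `exists_shellIdx`; `‖k‖_∞ ≤ |k|`).

Mathlib + `AbcClassIISynthesis`; no new definitions; std axioms. [folklore]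
-/

noncomputable section

open scoped BigOperators
open Finset

namespace Summit.NavierStokesRegularity.FluidComputer.AbcInertiaCI

open Literature.Analysis.FunctionSpaces Literature.Analysis.FunctionSpaces.Torus
open Literature.Analysis.FluidPDE
open Summit.NavierStokesRegularity.FluidComputer.AbcClassI
open Summit.NavierStokesRegularity.FluidComputer.AbcClassII (Fam crossForm secOp rotR rotS sgnAct sgnOrbit
  cube extend restrictTo extend_add extend_smul extend_zero rotR_add rotR_smul rotS_add rotS_smul
  crossForm_add crossForm_smul secOp_add secOp_smul restrictTo_add restrictTo_smul Orbit toOrbit onormSq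
  osupNorm cubeOrbits nbrOrbits mem_sgnOrbit mem_sgnOrbit_self card_sgnOrbit_le sgnOrbit_eq_of_mem
  mem_sgnOrbit_comm sgnOrbit_eq_or_disjoint neg_mem_sgnOrbit neg_self_mem_sgnOrbit rotFreqR_mem_sgnOrbit
  rotFreqS_mem_sgnOrbit freqNormSq_eq_of_mem_sgnOrbit supNorm_eq_of_mem_sgnOrbit mem_cube
  mem_cube_iff_supNorm cube_mono sgnOrbit_subset_cube zero_not_mem_sgnOrbit ne_zero_of_mem_sgnOrbit
  toOrbit_val toOrbit_eq_iff mem_cubeOrbits mem_nbrOrbits mem_nbrOrbits_comm card_nbrOrbits_le rotR_apply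
  rotS_apply freqNormSq_rotFreq secOp_conj isConjSymm_secOp kdot_secOp mem_iff_of_orbitClosed
  isConjSymm_cut kdot_cut orbitClosed_cube_ne_zero orbitClosed_shell neg_mem_of_orbitClosed
  isConjSymm_lerayCrossForm kdot_conj conj_eq_zero_of_not_mem linOp_zero_eq conj_theta_neg
  extend_apply_of_mem extend_apply_of_not_mem restrictTo_extend extend_restrictTo extend_sum
  inner_eq_sum_extend inner_conjVec_conjVec conj_sum_inner_of_isConjSymm sum_inner_eq_re_of_isConjSymm
  real_inner_eq_re real_smul_eq norm_lerayCrossForm_le sobolevWeight_one_eq cube_filter_eq_biUnion sum_cube_filter_eq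
  onormSq_nonneg)

/-! ### §1 Adjacency is Euclidean-local -/

/-- **Adjacent orbits differ by at most one in Euclidean norm**:
`j ∈ AbcClassI.nbrIdx i ⇒ √|O_j|² ≤ √|O_i|² + 1 ∧ √|O_i|² ≤ √|O_j|² + 1`. -/
theorem sqrt_onormSq_le_of_mem_nbrIdx {i j : AbcClassI.Idx} (h : j ∈ AbcClassI.nbrIdx i) :
    Real.sqrt (onormSq j.1) ≤ Real.sqrt (onormSq i.1) + 1 ∧
      Real.sqrt (onormSq i.1) ≤ Real.sqrt (onormSq j.1) + 1 := by
  obtain ⟨k, hk, s, hs, hks⟩ := mem_nbrOrbits.mp (mem_nbrIdx.mp h)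
  rw [← i.1.freqNormSq_eq hk, ← j.1.freqNormSq_eq hks]
  exact AbcInertia.sqrt_freqNormSq_sub_abcFreq k hs

/-! ### §2 (R4): the structure of the three index sets -/

section IndexSets

variable {rL rH : ℝ} (h0 : 0 ≤ rL) (hLH : rL + 1 ≤ rH)
variable {HL HH HB : Finset AbcClassI.Idx}
variable (hHL : ∀ i : AbcClassI.Idx, i ∈ HL ↔ onormSq i.1 ≤ rL ^ 2)
variable (hHH : ∀ i : AbcClassI.Idx, i ∈ HH ↔ onormSq i.1 ≤ rH ^ 2)
variable (hHB : ∀ i : AbcClassI.Idx, i ∈ HB ↔ rH ^ 2 < onormSq i.1 ∧ onormSq i.1 ≤ (rH + 1) ^ 2)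

include h0 hLH hHL hHH in
/-- `L ⊆ H`. -/
theorem HL_subset_HH : (HL : Finset AbcClassI.Idx) ⊆ HH := by
  intro i hi
  rw [hHH]
  have h1 := (hHL i).mp hi
  have : rL ^ 2 ≤ rH ^ 2 := pow_le_pow_left₀ h0 (by linarith) 2
  linarith

include h0 hLH hHL hHH in
/-- **(R4a) Neighbours of the head `L` lie in `H`** (`r_H ≥ r_L + 1`): the `L`-rows of `L − a` see only `H`. -/
theorem mem_HH_of_mem_nbrIdx_of_mem_HL {i j : AbcClassI.Idx} (hi : i ∈ HL) (hj : j ∈ AbcClassI.nbrIdx i) : j ∈ HH := by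
  rw [hHH]
  have hrH : 0 ≤ rH := by linarith
  rw [AbcInertia.onormSq_le_sq_iff hrH]
  have h1 := (sqrt_onormSq_le_of_mem_nbrIdx hj).1
  have h2 : Real.sqrt (onormSq i.1) ≤ rL := (AbcInertia.onormSq_le_sq_iff h0 i.1).mp ((hHL i).mp hi)
  linarith

include h0 hLH hHH hHB in
/-- **(R4b) Neighbours of `H` outside `H` lie in the first tail shell `B`.** -/
theorem mem_HB_of_mem_nbrIdx_of_mem_HH {i j : AbcClassI.Idx} (hi : i ∈ HH) (hj : j ∈ AbcClassI.nbrIdx i) (hjH : j ∉ HH) :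
    j ∈ HB := by
  have hrH : 0 ≤ rH := by linarith
  rw [hHB]
  rw [hHH] at hjH hi
  refine ⟨lt_of_not_ge hjH, ?_⟩
  rw [AbcInertia.onormSq_le_sq_iff (by linarith)]
  have h1 := (sqrt_onormSq_le_of_mem_nbrIdx hj).1
  have h2 : Real.sqrt (onormSq i.1) ≤ rH := (AbcInertia.onormSq_le_sq_iff hrH i.1).mp hi
  linarith

include h0 hLH hHL hHH hHB in
/-- **(R4c) An index outside `H` with a neighbour inside `H` lies in `B`, and that neighbour is outside `L`.** -/
theorem mem_HB_of_not_mem_HH {i j : AbcClassI.Idx} (hi : i ∉ HH) (hj : j ∈ AbcClassI.nbrIdx i) (hjH : j ∈ HH) :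
    i ∈ HB ∧ j ∉ HL := by
  have hrH : 0 ≤ rH := by linarith
  constructor
  · exact mem_HB_of_mem_nbrIdx_of_mem_HH h0 hLH hHH hHB hjH ((mem_nbrIdx_comm j i).mpr hj) hi
  · intro hjL
    exact hi (mem_HH_of_mem_nbrIdx_of_mem_HL h0 hLH hHL hHH hjL ((mem_nbrIdx_comm j i).mpr hj))

include h0 hLH hHL hHH hHB in
/-- `L` and `B` are not adjacent. -/
theorem not_mem_nbrIdx_of_HL_HB {i j : AbcClassI.Idx} (hi : i ∈ HL) (hj : j ∈ HB) : j ∉ AbcClassI.nbrIdx i := by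
  intro hmem
  have hjH := mem_HH_of_mem_nbrIdx_of_mem_HL h0 hLH hHL hHH hi hmem
  rw [hHH] at hjH
  have := ((hHB j).mp hj).1
  linarith

include h0 hLH hHL hHH hHB in
/-- **(R4d) `AbcClassI.amat` vanishes across `L × B`** (both orders). -/
theorem amat_eq_zero_of_HL_HB {i j : AbcClassI.Idx} (hi : i ∈ HL) (hj : j ∈ HB) : AbcClassI.amat i j = 0 ∧ AbcClassI.amat j i = 0 :=
  ⟨amat_eq_zero_of_not_mem (not_mem_nbrIdx_of_HL_HB h0 hLH hHL hHH hHB hi hj),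
    amat_eq_zero_of_not_mem fun h => not_mem_nbrIdx_of_HL_HB h0 hLH hHL hHH hHB hi hj
      ((mem_nbrIdx_comm j i).mp h)⟩

include hHH hHB in
/-- `B` lies outside `H`. -/
theorem not_mem_HH_of_mem_HB {i : AbcClassI.Idx} (hi : i ∈ HB) : i ∉ HH := by
  rw [hHH]; exact not_le.mpr ((hHB i).mp hi).1

include hHH hHB in
/-- `H ∩ B = ∅`. -/
theorem disjoint_HH_HB : Disjoint (HH : Finset AbcClassI.Idx) HB :=
  Finset.disjoint_right.mpr fun _ hi => not_mem_HH_of_mem_HB hHH hHB hi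

end IndexSets

/-! ### §3 (R3) per index -/

/-- (R3) outside `H`, for a membership-characterised `H`. -/
theorem tailConst_pos_of_not_mem {R a rH : ℝ} (hR : 0 < R)
    (hR3 : Real.sqrt 2 < ((⌊rH ^ 2⌋₊ : ℝ) + 1) / R + a) {HH : Finset AbcClassI.Idx}
    (hHH : ∀ i : AbcClassI.Idx, i ∈ HH ↔ onormSq i.1 ≤ rH ^ 2) {i : AbcClassI.Idx} (hi : i ∉ HH) :
    0 < onormSq i.1 / R + a - Real.sqrt 2 :=
  AbcInertia.tailConst_pos hR hR3 (lt_of_not_ge fun h => hi ((hHH i).mpr h))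

/-! ### §4 The index sets exist as `Finset`s -/

/-- **The ball index set exists**: `{i : |O_i|² ≤ r²}` is a `Finset`. -/
theorem exists_ballIdx (r : ℝ) : ∃ F : Finset AbcClassI.Idx, ∀ i : AbcClassI.Idx, i ∈ F ↔ onormSq i.1 ≤ r ^ 2 := by
  classical
  refine ⟨(AbcClassI.cubeIdx ⌈|r|⌉₊).filter (fun i => onormSq i.1 ≤ r ^ 2), fun i => ?_⟩
  rw [Finset.mem_filter, mem_cubeIdx]
  exact ⟨fun h => h.2, fun h => ⟨AbcInertia.osupNorm_le_of_onormSq_le h, h⟩⟩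

/-- **The shell index set exists**: `{i : r₁² < |O_i|² ≤ r₂²}` is a `Finset`. -/
theorem exists_shellIdx (r₁ r₂ : ℝ) :
    ∃ F : Finset AbcClassI.Idx, ∀ i : AbcClassI.Idx, i ∈ F ↔ r₁ ^ 2 < onormSq i.1 ∧ onormSq i.1 ≤ r₂ ^ 2 := by
  classical
  refine ⟨(AbcClassI.cubeIdx ⌈|r₂|⌉₊).filter (fun i => r₁ ^ 2 < onormSq i.1 ∧ onormSq i.1 ≤ r₂ ^ 2), fun i => ?_⟩
  rw [Finset.mem_filter, mem_cubeIdx]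
  exact ⟨fun h => h.2, fun h => ⟨AbcInertia.osupNorm_le_of_onormSq_le h.2, h⟩⟩

end Summit.NavierStokesRegularity.FluidComputer.AbcInertiaCI

end
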